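import Summits.BirchSwinnertonDyer.BirchSwinnertonDyer.Theorems.BiquadraticEisensteinDescentEisensteinHeartFlatCMInertBadKPrimeRangeInfinite
import Literature.NumberTheory.EllipticCurves.IntSeriesIdentityPrinciple
import Literature.NumberTheory.EllipticCurves.DeShalit1987.KatzMeasureMonomialLinesFrames
import Summits.BirchSwinnertonDyer.Rank1Residual.X11b.Three.LambdaSupplyTeichmueller
import HarnessLib

set_option linter.dupNamespace false
set_option autoImplicit false

/-!
# Crux `EisensteinHeartFlatCMInertBadKPrime` (stmt-BirchSwinnertonDyer-21341), line `hsieh_lambda` v8.1 — RANGE RIGIDITY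
# (helper, `--supports … --as helper`): a series `G ∈ 𝓞_{ℂ_p}⟦T⟧` is DETERMINED by its values on Hsieh's range

Lead seat `bsd-wall-cm-bed-p1` g11. Theorems only; nothing is closed; BSD is not proved by any of this.

Skeleton v8.1 (`Cruxes/EisensteinHeartFlatCMInertBadKPrime/Lines/hsieh_lambda.lean`, sha16 cee5ef481565d6d4) leaves ONE registered stub, the
research residue `stub_V4Rr`: the divisibility `∃ m, p^m·Ch(N)·𝓞⟦T⟧ ⊆ (G)` for EVERY `G` taking the Katz-normalised values on Hsieh's
range, GIVEN a non-torsion point of the range (`hsiehRangeWitness` = R3∘R2∘R1, landed p719262/p719120/p719685). This file records the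
consequence its prover will use first: such a `G` is UNIQUE for a fixed frame, so the `∀ G` of the stub is a statement about ONE series.

* `IntSeries_eq_of_hasValueAt_pow_sub_one` — two series in `𝓞_{ℂ_p}⟦T⟧` with the same value at every node `u^q − 1`, `q ≥ 1`, where
  `‖1 − u‖ < 1` and `u` is not a root of unity, are EQUAL: the nodes are infinitely many distinct points of the closed disc
  `‖x‖ ≤ ‖u − 1‖ < 1` (`‖1 − u^q‖ ≤ ‖1 − u‖`, `LambdaSupply.PadicUnits.norm_one_sub_pow_le`), and the tree's identity principle on closed
  discs (`IntSeries.eq_of_infinite_hasValueAt_eq`, Gouvêa Cor. 5.6.4) applies.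
* `eq_of_hasValueAt_range` — frame-abstracted uniqueness: if `G` and `G'` both take, at the node `r(γ) − 1` of EVERY point `(χ, n, r)` of
  Hsieh's range (χ everywhere unramified of type `(n, −n)`, `n > 0`, `r` a `p`-adic avatar of `χ` through `κ`), a value `val χ n` depending
  only on `(χ, n)` — as the Katz-normalised value of `stub_V4Rr` does — and the range has a non-torsion point `(χ₀, n₀, r₀)` (which
  `hsiehRangeWitness` supplies for every crux datum), then `G = G'`: the powers `(χ₀^q, q n₀, e ∘ ψ₀^q)` are points of the range
  (`isUnramifiedAt_pow'`, `HasInfinityType.pow_nat`, `isPAdicAvatarOf_pow`, `factorsThroughZp_unitsChar_iff`) with nodes `u^q − 1`,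
  `u = r₀(γ)` (`avatarValueAt_unitsChar_pow`), `‖u − 1‖ < 1` (`ZpExtension.norm_avatarValueAt_sub_one_lt`).

References: [Gouvea1993PadicNumbers] §5.6 Cor. 5.6.4; [deShalit1987] II.4.17; [Washington1997] §13.1; [Hsieh2014Crelle] Prop. 4.9.
-/

noncomputable section

open scoped NumberField
open NumberField IsDedekindDomain Field Filter Topology
  Literature.NumberTheory.GaloisRepresentations Literature.NumberTheory.EllipticCurves
  Summit.BirchSwinnertonDyer.Rank1Residual.X11b.Three.LambdaSupply

namespace Summit.BirchSwinnertonDyer.BirchSwinnertonDyer.Theorems.BiquadraticEisensteinDescentEisensteinHeartFlatCMInertBadKPrimeRangeRigidity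

variable {p : ℕ} [Fact p.Prime]

/-- **Identity principle on the nodes `u^q − 1`.** If `‖1 − u‖ < 1`, `u^q ≠ 1` for all `q ≥ 1`, and `Q`, `Q'` take a common value at
every node `u^q − 1` (`q ≥ 1`), then `Q = Q'`. [cite: Gouvea1993PadicNumbers, §5.6 Cor. 5.6.4] -/
theorem IntSeries_eq_of_hasValueAt_pow_sub_one {u : ℂ_[p]} (hu : ‖1 - u‖ < 1) (hnt : ∀ q : ℕ, 0 < q → u ^ q ≠ 1)
    {Q Q' : PowerSeries (PadicComplexInt p)}
    (h : ∀ q : ℕ, 0 < q → ∃ v : ℂ_[p], IntSeries.HasValueAt Q (u ^ q - 1) v ∧ IntSeries.HasValueAt Q' (u ^ q - 1) v) :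
    Q = Q' := by
  have hu1 : u ≠ 1 := fun h1 => hnt 1 one_pos (by rw [pow_one, h1])
  have hϖ0 : u - 1 ≠ 0 := sub_ne_zero.mpr hu1
  have hϖ : ‖u - 1‖ < 1 := by rwa [norm_sub_rev]
  refine IntSeries.eq_of_infinite_hasValueAt_eq hϖ0 hϖ ?_
  -- the nodes `u^(q+1) - 1`, `q ∈ ℕ`, are pairwise distinct and lie in the closed disc of radius `‖u - 1‖`
  have hinj : Function.Injective fun q : ℕ => u ^ (q + 1) - 1 := by
    intro a b hab
    simp only [sub_left_inj] at hab
    by_contra hne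
    have hu0 : u ≠ 0 := by
      intro h0
      rw [h0, sub_zero, norm_one] at hu
      exact lt_irrefl _ hu
    rcases Nat.lt_or_gt_of_ne hne with hlt | hlt
    · have := hnt (b - a) (Nat.sub_pos_of_lt hlt)
      apply this
      have e : u ^ (b + 1) = u ^ (a + 1) * u ^ (b - a) := by rw [← pow_add]; congr 1; omega
      rw [e] at hab
      exact (mul_eq_left₀ (pow_ne_zero _ hu0)).mp hab.symm
    · have := hnt (a - b) (Nat.sub_pos_of_lt hlt)
      apply this
      have e : u ^ (a + 1) = u ^ (b + 1) * u ^ (a - b) := by rw [← pow_add]; congr 1; omega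
      rw [e] at hab
      exact (mul_eq_left₀ (pow_ne_zero _ hu0)).mp hab
  refine Set.infinite_of_injective_forall_mem hinj fun q => ⟨?_, h (q + 1) (Nat.succ_pos q)⟩
  rw [norm_sub_rev, norm_sub_rev u]
  exact PadicUnits.norm_one_sub_pow_le hu (q + 1)

variable {K : Type} [Field K] [NumberField K]

/-- **A series is determined by its values on Hsieh's range** (frame-abstracted): let `val χ n ∈ ℂ_p` depend only on the Hecke character
`χ` and the weight `n`. If `G` and `G'` both satisfy `HasValueAt · (r(γ) − 1) (val χ n)` at every point `(χ, n, r)` of the range through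
`κ` (χ everywhere unramified of type `(n, −n)`, `n > 0`, `IsPAdicAvatarOf ι χ r`, `FactorsThroughZp κ r`), and the range has a point
`(χ₀, n₀, r₀)` with `r₀(γ)` not a root of unity (`γ` a topological generator of `κ`), then `G = G'`.
[cite: Gouvea1993PadicNumbers, §5.6 Cor. 5.6.4] [cite: deShalit1987, II.4.17] -/
theorem eq_of_hasValueAt_range (κ : ZpExtension K p) {γ : absoluteGaloisGroup K} (hγ : κ.IsTopGenerator γ)
    (ι : PadicAlgCl p ≃+* ℂ) (val : HeckeCharacter K → ℕ → ℂ_[p]) {G G' : PowerSeries (PadicComplexInt p)}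
    (hG : ∀ (χ : HeckeCharacter K) (n : ℕ), 0 < n → (∀ v : HeightOneSpectrum (𝓞 K), χ.IsUnramifiedAt v) →
      χ.HasInfinityType (fun _ ↦ (n : ℤ)) (fun _ ↦ -(n : ℤ)) →
      ∀ r : FramedGaloisRep K (PadicAlgCl p) 1, IsPAdicAvatarOf ι χ r → FactorsThroughZp κ r →
        IntSeries.HasValueAt G (avatarValueAt r γ - 1) (val χ n))
    (hG' : ∀ (χ : HeckeCharacter K) (n : ℕ), 0 < n → (∀ v : HeightOneSpectrum (𝓞 K), χ.IsUnramifiedAt v) →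
      χ.HasInfinityType (fun _ ↦ (n : ℤ)) (fun _ ↦ -(n : ℤ)) →
      ∀ r : FramedGaloisRep K (PadicAlgCl p) 1, IsPAdicAvatarOf ι χ r → FactorsThroughZp κ r →
        IntSeries.HasValueAt G' (avatarValueAt r γ - 1) (val χ n))
    (hR : ∃ (χ : HeckeCharacter K) (n : ℕ) (r : FramedGaloisRep K (PadicAlgCl p) 1), 0 < n ∧
      (∀ v : HeightOneSpectrum (𝓞 K), χ.IsUnramifiedAt v) ∧
      χ.HasInfinityType (fun _ ↦ (n : ℤ)) (fun _ ↦ -(n : ℤ)) ∧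
      IsPAdicAvatarOf ι χ r ∧ FactorsThroughZp κ r ∧ ∀ q : ℕ, 0 < q → avatarValueAt r γ ^ q ≠ 1) :
    G = G' := by
  obtain ⟨χ₀, n₀, r₀, hn₀, hu₀, ht₀, hav₀, hfac₀, hnt⟩ := hR
  -- the currency `r₀ = e ∘ ψ₀`
  set e := (FramedRep.unitsContinuousMulEquivOfUnique (Fin 1) (PadicAlgCl p) :
    (PadicAlgCl p)ˣ →ₜ* GL (Fin 1) (PadicAlgCl p)) with he
  set ψ₀ : absoluteGaloisGroup K →ₜ* (PadicAlgCl p)ˣ :=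
    ((FramedRep.unitsContinuousMulEquivOfUnique (Fin 1) (PadicAlgCl p)).symm :
      GL (Fin 1) (PadicAlgCl p) →ₜ* (PadicAlgCl p)ˣ).comp r₀ with hψ₀
  have hr₀ : r₀ = e.comp ψ₀ := by rw [hψ₀, he, comp_symm_comp_eq]
  rw [hr₀] at hav₀ hfac₀ hnt
  set u : ℂ_[p] := avatarValueAt (e.comp ψ₀) γ with hudef
  have hu : ‖1 - u‖ < 1 := by
    rw [norm_sub_rev]; exact ZpExtension.norm_avatarValueAt_sub_one_lt hfac₀ hγ
  have hχ₀u' : ∀ v : HeightOneSpectrum (𝓞 K), ((p : ℕ) : 𝓞 K) ∉ v.asIdeal → χ₀.IsUnramifiedAt v := fun v _ => hu₀ v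
  refine IntSeries_eq_of_hasValueAt_pow_sub_one hu hnt fun q hq => ?_
  -- the point `(χ₀^q, q n₀, e ∘ ψ₀^q)` of the range and its node `u^q - 1`
  have hunr : ∀ v : HeightOneSpectrum (𝓞 K), (χ₀ ^ q).IsUnramifiedAt v := fun v => isUnramifiedAt_pow' (hu₀ v) q
  have htype : (χ₀ ^ q).HasInfinityType (fun _ ↦ ((q * n₀ : ℕ) : ℤ)) (fun _ ↦ -((q * n₀ : ℕ) : ℤ)) := by
    have h := Summit.BirchSwinnertonDyer.Rank1Residual.X11b.LambdaSupply.HasInfinityType.pow_nat ht₀ q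
    have e1 : (fun _ : InfinitePlace K ↦ (q : ℤ) * (n₀ : ℤ)) = fun _ ↦ ((q * n₀ : ℕ) : ℤ) := by funext w; push_cast; ring
    have e2 : (fun _ : InfinitePlace K ↦ (q : ℤ) * -(n₀ : ℤ)) = fun _ ↦ -((q * n₀ : ℕ) : ℤ) := by funext w; push_cast; ring
    rw [e1, e2] at h
    exact h
  have hav : IsPAdicAvatarOf ι (χ₀ ^ q) (e.comp (ψ₀ ^ q)) := isPAdicAvatarOf_pow ι hav₀ hχ₀u' q
  have hfac : FactorsThroughZp κ (e.comp (ψ₀ ^ q)) := by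
    rw [factorsThroughZp_unitsChar_iff] at hfac₀ ⊢
    intro σ hσ
    rw [ContinuousMonoidHom.pow_apply, hfac₀ σ hσ, one_pow]
  have hnode : avatarValueAt (e.comp (ψ₀ ^ q)) γ = u ^ q :=
    Summit.BirchSwinnertonDyer.Rank1Residual.X11b.LambdaSupply.avatarValueAt_unitsChar_pow ψ₀ γ q
  refine ⟨val (χ₀ ^ q) (q * n₀), ?_, ?_⟩
  · have h1 := hG (χ₀ ^ q) (q * n₀) (Nat.mul_pos hq hn₀) hunr htype _ hav hfac
    rwa [hnode] at h1
  · have h2 := hG' (χ₀ ^ q) (q * n₀) (Nat.mul_pos hq hn₀) hunr htype _ hav hfac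
    rwa [hnode] at h2

end Summit.BirchSwinnertonDyer.BirchSwinnertonDyer.Theorems.BiquadraticEisensteinDescentEisensteinHeartFlatCMInertBadKPrimeRangeRigidity

end
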